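import Summits.BirchSwinnertonDyer.Rank1Residual.Additive.QuadraticBranchMazurTateElement
import HarnessLib

/-!
# The three-term relation of the quadratic-branch Mazur–Tate elements at `a_p = 0` and the
# divisibility `ω⁺_{2m+1} ∣ θ_{2m+1}(f, η)` with compatible quotients (proofs only), file 2 of 5
# towards the EXISTENCE of Kobayashi's `L_p⁻(V, η, X)`

HONEST FRAMING (cell `bsd-potss`, run/shared/lean/pub/bsd-potss/, FULL-BSD rank ≤ 1 programme
tranche 1b, human ruling D-0036; seat `bsd-potss-ctrl` = "signed control along the quadratic branch"):
the programme's target of record is FULL BSD for every analytic-rank ≤ 1 curve over `ℚ`; this seat's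
object is the quadratic (`η = ω^{(p−1)/2}`) branch of Kobayashi's signed theory for the good
`a_p = 0` twin `V` of an additive potentially supersingular curve `W = V ⊗ η` (classes Gss2 / O5 `e = 2`,
O10-PS). THIS FILE: THEOREMS ONLY (no definition, no `sorry`); NOTHING about `BSD(W, p)`, (C1_η), (C2_η-GZ) or (C3_η) of any pair is claimed
or moved; no named Literature fact is introduced; axioms standard.

## Contents

* `cyclotomicOmega_dvd_quadraticBranchMazurTateElement_add`: `ω_{n+1} ∣ θ_{n+2}(η) + Φ_{p^{n+1}}(1+T) θ_n(η)`
  in `ℚ[T]` — Mazur–Tate–Teitelbaum §I.10 (10.2) on the `η`-component (the tame sign `η(w)` is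
  constant along the fibres of `(ℤ/p^{n+2})^× → (ℤ/p^{n+1})^×`); port of the tree's
  `cyclotomicOmega_dvd_mazurTateElement_add`.
* `cyclotomicOmegaPlus_dvd_quadraticBranchMazurTateElement`: `ω⁺_{2m+1} ∣ θ_{2m+1}(η)` — the trivial
  zeros at the roots of unity of EVEN order `p^{2k}`, `2k ≤ 2m+1`, i.e. Kobayashi's factor
  `∏_{even k ≤ n} Φ_k(ζ)^{−1}` of (3.5).
* `X_mul_cyclotomicOmegaMinus_dvd_sub_quadraticBranch`: the signed quotients
  `(−1)^{m+1} θ_{2m+1}(η)/ω⁺_{2m+1}` are compatible modulo `T ω⁻_{2m+1}`.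

References: [Kobayashi2003] Thm. 3.2 and (3.5) (p. 7); [Pollack2003] Prop. 6.18;
[MazurTateTeitelbaum1986Invent] §I.10 Prop. (10.2).
-/

noncomputable section

open scoped Classical MatrixGroups ModularForm

open CongruenceSubgroup Polynomial Literature.NumberTheory.EllipticCurves
  Literature.NumberTheory.EllipticCurves.ModularForms

namespace Summit.BirchSwinnertonDyer.Rank1Residual.Additive

/-! ## §3 The three-term relation `θ_{n+2}(η) ≡ −Φ_{p^{n+1}}(1+T) · θ_n(η) (mod ω_{n+1})` -/

section ThreeTerm

variable {N : ℕ} [NeZero N] {f : CuspForm (Gamma0 N) 2} {p : ℕ} [Fact p.Prime]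

omit [NeZero N] [Fact p.Prime] in
/-- Reindexing a sum over `ℤ/m` by the representatives `0 ≤ a.val < m`. [folklore] -/
private theorem sum_univ_zmod_val' {M : Type*} [AddCommMonoid M] (m : ℕ) [NeZero m] (g : ℕ → M) :
    ∑ a : ZMod m, g a.val = ∑ k ∈ Finset.range m, g k := by
  refine Finset.sum_bij (fun a _ ↦ a.val) (fun a _ ↦ Finset.mem_range.mpr (ZMod.val_lt a))
    (fun a _ b _ h ↦ ZMod.val_injective m h) (fun k hk ↦ ?_) (fun _ _ ↦ rfl)
  exact ⟨(k : ZMod m), Finset.mem_univ _, ZMod.val_cast_of_lt (Finset.mem_range.mp hk)⟩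

omit [NeZero N] [Fact p.Prime] in
/-- `∑_{k < a·b} g(k) = ∑_{j < a} ∑_{t < b} g(t + b·j)`. [folklore] -/
private theorem sum_range_mul_eq_sum_sum' {M : Type*} [AddCommMonoid M] (a b : ℕ) (g : ℕ → M) :
    ∑ k ∈ Finset.range (a * b), g k =
      ∑ j ∈ Finset.range a, ∑ t ∈ Finset.range b, g (t + b * j) := by
  rw [← Fin.sum_univ_eq_sum_range g (a * b),
    ← finProdFinEquiv.sum_comp (fun x : Fin (a * b) ↦ g x), Fintype.sum_prod_type,
    ← Fin.sum_univ_eq_sum_range (fun j ↦ ∑ t ∈ Finset.range b, g (t + b * j)) a]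
  refine Finset.sum_congr rfl fun j _ ↦ ?_
  rw [← Fin.sum_univ_eq_sum_range (fun t ↦ g (t + b * j)) b]
  refine Finset.sum_congr rfl fun t _ ↦ ?_
  rw [finProdFinEquiv_apply_val]

omit [NeZero N] in
/-- The image of `θ_m(η)` under a ring homomorphism `φ : ℚ[T] → R`:
`φ(θ_m(η)) = ∑_w ∑_{k < p^m} φ(η(w)[w γ^k / p^{m+e₀}]^δ) · φ(1+T)^k`. [folklore] -/
theorem map_quadraticBranchMazurTateElement_eq {R : Type*} [CommRing R] (φ : ℚ[X] →+* R) (m : ℕ)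
    [Fintype (rootsOfUnity (torsionOrder p) ℤ_[p])] :
    φ (quadraticBranchMazurTateElement p f m) =
      ∑ w : rootsOfUnity (torsionOrder p) ℤ_[p], ∑ k ∈ Finset.range (p ^ m),
        φ (C ((teichSign p w : ℚ) * branchSymbol p f
          (((PadicInt.toZModPow (m + cyclotomicExponent p) ((w : ℤ_[p]ˣ) : ℤ_[p]) *
              (cyclotomicGenerator p : ZMod (p ^ (m + cyclotomicExponent p))) ^ k).val : ℚ) /
            (p : ℚ) ^ (m + cyclotomicExponent p)))) * φ (X + 1) ^ k := by
  classical
  haveI : NeZero (p ^ m) := ⟨pow_ne_zero _ (Fact.out : p.Prime).ne_zero⟩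
  rw [quadraticBranchMazurTateElement, finsum_eq_sum_of_fintype, map_sum]
  refine Finset.sum_congr rfl fun w _ ↦ ?_
  rw [map_sum, ← sum_univ_zmod_val' (p ^ m) (fun k ↦ φ (C ((teichSign p w : ℚ) * branchSymbol p f
          (((PadicInt.toZModPow (m + cyclotomicExponent p) ((w : ℤ_[p]ˣ) : ℤ_[p]) *
              (cyclotomicGenerator p : ZMod (p ^ (m + cyclotomicExponent p))) ^ k).val : ℚ) /
            (p : ℚ) ^ (m + cyclotomicExponent p)))) * φ (X + 1) ^ k)]
  refine Finset.sum_congr rfl fun s _ ↦ ?_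
  rw [map_mul, map_pow]

/-- **The three-term relation of the quadratic-branch Mazur–Tate elements at `a_p = 0`**: in `ℚ[T]`,
`ω_{n+1} ∣ θ_{n+2}(η) + Φ_{p^{n+1}}(1+T) · θ_n(η)` (Mazur–Tate–Teitelbaum 1986, §I.10:
`π_{n+2/n+1}(θ_{n+2}) = a_p θ_{n+1} − ν_{n/n+1}(θ_n)` component by component — the tame sign `η(w)`
is constant along the fibres `w γ^t · (γ^{p^{n+1}})^j`). Port of the tree's
`cyclotomicOmega_dvd_mazurTateElement_add` (trivial branch). [cite: MazurTateTeitelbaum1986Invent, §I.10 Prop. (10.2)] -/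
theorem cyclotomicOmega_dvd_quadraticBranchMazurTateElement_add (hf0 : IsNewform0 f)
    (hQ : coeffField f = ⊥) (hpN : ¬ p ∣ N) (hap : cuspCoeff f p = ((0 : ℤ) : ℂ)) (n : ℕ) :
    (cyclotomicOmega p (n + 1)).map (Int.castRingHom ℚ) ∣
      quadraticBranchMazurTateElement p f (n + 2) +
        ((cyclotomic (p ^ (n + 1)) ℤ).comp (X + 1)).map (Int.castRingHom ℚ) *
          quadraticBranchMazurTateElement p f n := by
  classical
  have hp : p.Prime := Fact.out
  haveI := neZero_torsionOrder p
  haveI := Fintype.ofFinite (rootsOfUnity (torsionOrder p) ℤ_[p])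
  have hIS : n + 1 + (cyclotomicExponent p) = (n + (cyclotomicExponent p)) + 1 := by omega
  have hBI : n + 2 + (cyclotomicExponent p) = (n + 1 + (cyclotomicExponent p)) + 1 := by omega
  have hdvdIS : p ^ (n + (cyclotomicExponent p)) ∣ p ^ (n + 1 + (cyclotomicExponent p)) :=
    pow_dvd_pow p (by omega)
  have hdvdBI : p ^ (n + 1 + (cyclotomicExponent p)) ∣ p ^ (n + 2 + (cyclotomicExponent p)) :=
    pow_dvd_pow p (by omega)
  set ωQ : ℚ[X] := (cyclotomicOmega p (n + 1)).map (Int.castRingHom ℚ) with hωQ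
  rw [← AdjoinRoot.mk_eq_zero]
  set π : ℚ[X] →+* AdjoinRoot ωQ := AdjoinRoot.mk ωQ with hπ
  set u : AdjoinRoot ωQ := π (X + 1) with hu
  have hu1 : u ^ p ^ (n + 1) = 1 := by
    have hω : ((X : ℚ[X]) + 1) ^ p ^ (n + 1) - 1 = ωQ := by
      rw [hωQ, cyclotomicOmega, Polynomial.map_sub, Polynomial.map_pow, Polynomial.map_add,
        Polynomial.map_X, Polynomial.map_one]
    have h0 : π (((X : ℚ[X]) + 1) ^ p ^ (n + 1) - 1) = 0 := by
      rw [hω]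
      exact AdjoinRoot.mk_self
    rw [map_sub, map_pow, map_one, sub_eq_zero] at h0
    rw [hu, h0]
  have hupow : ∀ a b : ℕ, u ^ (a + p ^ (n + 1) * b) = u ^ a := fun a b ↦ by
    rw [pow_add, pow_mul, hu1, one_pow, mul_one]
  have hγS : (cyclotomicGenerator p : ZMod (p ^ (n + (cyclotomicExponent p)))) ^ p ^ n = 1 := by
    rw [← orderOf_cyclotomicGenerator p n, pow_orderOf_eq_one]
  have hγI : (cyclotomicGenerator p : ZMod (p ^ (n + 1 + (cyclotomicExponent p)))) ^ p ^ (n + 1) =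
      1 := by
    rw [← orderOf_cyclotomicGenerator p (n + 1), pow_orderOf_eq_one]
  have hδord : orderOf ((cyclotomicGenerator p :
      ZMod (p ^ (n + 2 + (cyclotomicExponent p)))) ^ p ^ (n + 1)) = p := by
    rw [orderOf_pow' _ (pow_ne_zero _ hp.ne_zero), orderOf_cyclotomicGenerator p (n + 2),
      Nat.gcd_eq_right (pow_dvd_pow p (by omega : n + 1 ≤ n + 2)), Nat.pow_div (by omega) hp.pos,
      show n + 2 - (n + 1) = 1 by omega, pow_one]
  have hδ1 : ZMod.castHom hdvdBI (ZMod (p ^ (n + 1 + (cyclotomicExponent p))))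
      ((cyclotomicGenerator p : ZMod (p ^ (n + 2 + (cyclotomicExponent p)))) ^ p ^ (n + 1)) = 1 := by
    rw [map_pow, map_natCast, hγI]
  have hpdiv : ∀ v : ℚ, (p : ℚ) * (v / (p : ℚ) ^ (n + 1 + (cyclotomicExponent p))) =
      v / (p : ℚ) ^ (n + (cyclotomicExponent p)) := by
    intro v
    have hp0 : (p : ℚ) ≠ 0 := Nat.cast_ne_zero.mpr hp.ne_zero
    rw [hIS, pow_succ]
    field_simp
  -- the common value
  set A : rootsOfUnity (torsionOrder p) ℤ_[p] → ℕ → ℚ := fun w k ↦ (teichSign p w : ℚ) *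
    branchSymbol p f
    (((PadicInt.toZModPow (n + (cyclotomicExponent p)) ((w : ℤ_[p]ˣ) : ℤ_[p]) *
        (cyclotomicGenerator p : ZMod (p ^ (n + (cyclotomicExponent p)))) ^ k).val : ℚ) /
      (p : ℚ) ^ (n + (cyclotomicExponent p))) with hA
  set T : AdjoinRoot ωQ := ∑ w : rootsOfUnity (torsionOrder p) ℤ_[p], ∑ k ∈ Finset.range p,
    ∑ t ∈ Finset.range (p ^ n), π (C (A w t)) * (u ^ t * (u ^ p ^ n) ^ k) with hT
  have hθn : π (quadraticBranchMazurTateElement p f n) =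
      ∑ w : rootsOfUnity (torsionOrder p) ℤ_[p], ∑ t ∈ Finset.range (p ^ n),
        π (C (A w t)) * u ^ t := by
    rw [map_quadraticBranchMazurTateElement_eq π n]
  have hξ : π (((cyclotomic (p ^ (n + 1)) ℤ).comp (X + 1)).map (Int.castRingHom ℚ)) =
      ∑ k ∈ Finset.range p, (u ^ p ^ n) ^ k := by
    rw [cyclotomic_prime_pow_eq_geom_sum hp, Polynomial.sum_comp, Polynomial.map_sum, map_sum]
    refine Finset.sum_congr rfl fun k _ ↦ ?_
    rw [pow_comp, pow_comp, X_comp, Polynomial.map_pow, Polynomial.map_pow, Polynomial.map_add,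
      Polynomial.map_X, Polynomial.map_one, map_pow, map_pow]
  have hRHS : π (((cyclotomic (p ^ (n + 1)) ℤ).comp (X + 1)).map (Int.castRingHom ℚ)) *
      π (quadraticBranchMazurTateElement p f n) = T := by
    rw [hξ, hθn, Finset.mul_sum]
    refine Finset.sum_congr rfl fun w _ ↦ ?_
    rw [Finset.sum_mul]
    refine Finset.sum_congr rfl fun k _ ↦ ?_
    rw [Finset.mul_sum]
    refine Finset.sum_congr rfl fun t _ ↦ ?_
    ring
  have hLHS : π (quadraticBranchMazurTateElement p f (n + 2)) = -T := by
    rw [map_quadraticBranchMazurTateElement_eq π (n + 2), ← hu]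
    -- Step 1: `k = t + p^{n+1} j`, the `j`-sum is an orbit sum
    have h1 : ∀ w : rootsOfUnity (torsionOrder p) ℤ_[p],
        ∑ k ∈ Finset.range (p ^ (n + 2)),
          π (C ((teichSign p w : ℚ) * branchSymbol p f
            (((PadicInt.toZModPow (n + 2 + (cyclotomicExponent p)) ((w : ℤ_[p]ˣ) : ℤ_[p]) *
                (cyclotomicGenerator p : ZMod (p ^ (n + 2 + (cyclotomicExponent p)))) ^ k).val : ℚ) /
              (p : ℚ) ^ (n + 2 + (cyclotomicExponent p))))) * u ^ k =
        -∑ t ∈ Finset.range (p ^ (n + 1)),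
          π (C ((teichSign p w : ℚ) * branchSymbol p f
            (((PadicInt.toZModPow (n + 1 + (cyclotomicExponent p)) ((w : ℤ_[p]ˣ) : ℤ_[p]) *
                (cyclotomicGenerator p : ZMod (p ^ (n + 1 + (cyclotomicExponent p)))) ^ t).val : ℚ) /
              (p : ℚ) ^ (n + (cyclotomicExponent p))))) * u ^ t := by
      intro w
      rw [show p ^ (n + 2) = p * p ^ (n + 1) by ring, sum_range_mul_eq_sum_sum', Finset.sum_comm,
        ← Finset.sum_neg_distrib]
      refine Finset.sum_congr rfl fun t _ ↦ ?_
      simp_rw [hupow t]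
      rw [← Finset.sum_mul, ← map_sum, ← map_sum, ← neg_mul, ← map_neg, ← C_neg]
      congr 3
      -- the orbit sum, with the constant sign `η(w)` factored out
      set b₀ : ZMod (p ^ (n + 2 + (cyclotomicExponent p))) :=
        PadicInt.toZModPow (n + 2 + (cyclotomicExponent p)) ((w : ℤ_[p]ˣ) : ℤ_[p]) *
        (cyclotomicGenerator p : ZMod (p ^ (n + 2 + (cyclotomicExponent p)))) ^ t with hb₀
      have hb₀u : IsUnit b₀ :=
        ((Units.isUnit _).map _).mul ((isUnit_cyclotomicGenerator_cast p _).pow _)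
      have horb := sum_range_branchSymbol_orbit_eq_neg hf0 hQ hpN hap hBI hdvdBI hb₀u hδord hδ1
      have hcast : ZMod.castHom hdvdBI (ZMod (p ^ (n + 1 + (cyclotomicExponent p)))) b₀ =
          PadicInt.toZModPow (n + 1 + (cyclotomicExponent p)) ((w : ℤ_[p]ˣ) : ℤ_[p]) *
            (cyclotomicGenerator p : ZMod (p ^ (n + 1 + (cyclotomicExponent p)))) ^ t := by
        rw [hb₀, map_mul, map_pow, map_natCast, ZMod.castHom_apply,
          PadicInt.cast_toZModPow _ _ (by omega)]
      rw [hcast, hpdiv] at horb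
      rw [← mul_neg, ← horb, Finset.mul_sum]
      refine Finset.sum_congr rfl fun j _ ↦ ?_
      rw [hb₀, pow_add (cyclotomicGenerator p : ZMod (p ^ (n + 2 + (cyclotomicExponent p)))) t
          (p ^ (n + 1) * j),
        pow_mul (cyclotomicGenerator p : ZMod (p ^ (n + 2 + (cyclotomicExponent p)))) (p ^ (n + 1)) j,
        mul_assoc]
    -- Step 2: `[p · x/p^{n+1+e₀}]^δ = [(x mod p^{n+e₀})/p^{n+e₀}]^δ` and `t = t' + p^n k`
    have h2 : ∀ w : rootsOfUnity (torsionOrder p) ℤ_[p],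
        ∑ t ∈ Finset.range (p ^ (n + 1)),
          π (C ((teichSign p w : ℚ) * branchSymbol p f
            (((PadicInt.toZModPow (n + 1 + (cyclotomicExponent p)) ((w : ℤ_[p]ˣ) : ℤ_[p]) *
                (cyclotomicGenerator p : ZMod (p ^ (n + 1 + (cyclotomicExponent p)))) ^ t).val : ℚ) /
              (p : ℚ) ^ (n + (cyclotomicExponent p))))) * u ^ t =
        ∑ k ∈ Finset.range p, ∑ t ∈ Finset.range (p ^ n),
          π (C (A w t)) * (u ^ t * (u ^ p ^ n) ^ k) := by
      intro w
      rw [show p ^ (n + 1) = p * p ^ n by ring, sum_range_mul_eq_sum_sum']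
      refine Finset.sum_congr rfl fun k _ ↦ ?_
      refine Finset.sum_congr rfl fun t _ ↦ ?_
      have hx : ∀ x : ZMod (p ^ (n + 1 + (cyclotomicExponent p))),
          branchSymbol p f ((x.val : ℚ) / (p : ℚ) ^ (n + (cyclotomicExponent p))) =
            branchSymbol p f (((ZMod.castHom hdvdIS (ZMod (p ^ (n + (cyclotomicExponent p)))) x).val : ℚ) /
              (p : ℚ) ^ (n + (cyclotomicExponent p))) := by
        intro x
        rw [← branchSymbol_mul_div_pow_eq hIS hdvdIS x, hpdiv]
      rw [hx, map_mul (ZMod.castHom hdvdIS (ZMod (p ^ (n + cyclotomicExponent p)))),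
        map_pow (ZMod.castHom hdvdIS (ZMod (p ^ (n + cyclotomicExponent p)))), map_natCast,
        ZMod.castHom_apply, PadicInt.cast_toZModPow _ _ (by omega),
        pow_add (cyclotomicGenerator p : ZMod (p ^ (n + (cyclotomicExponent p)))) t (p ^ n * k),
        pow_mul (cyclotomicGenerator p : ZMod (p ^ (n + (cyclotomicExponent p)))) (p ^ n) k, hγS,
        one_pow, mul_one, pow_add u t (p ^ n * k), pow_mul u (p ^ n) k]
    simp_rw [h1, h2]
    rw [hT, ← Finset.sum_neg_distrib]
  rw [map_add, map_mul, hLHS, hRHS, neg_add_cancel]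

end ThreeTerm

/-! ## §4 `ω⁺_{2m+1} ∣ θ_{2m+1}(η)` and the compatible quotients -/

section Quotients

variable {N : ℕ} [NeZero N] {f : CuspForm (Gamma0 N) 2} {p : ℕ} [Fact p.Prime]

/-- **`ω⁺_{2m+1} ∣ θ_{2m+1}(η)` in `ℚ[T]`** (`a_p = 0`), by induction from the three-term relation at
the odd levels (`ω⁺_1 = 1`; `ω⁺_{2m+3} = ω⁺_{2m+1} Φ_{p^{2m+2}}(1+T)`): `θ_{2m+1}(η)` vanishes at
`ζ − 1` for every `ζ` of order `p^k`, `k` even, `2 ≤ k ≤ 2m` — Kobayashi's factor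
`∏_{even k ≤ n} Φ_k(ζ)^{−1}` of (3.5). Port of the tree's `cyclotomicOmegaPlus_dvd_mazurTateElement`.
[cite: Kobayashi2003, (3.5) (p. 7)] [cite: Pollack2003, Prop. 6.18 (proof)] -/
theorem cyclotomicOmegaPlus_dvd_quadraticBranchMazurTateElement (hf0 : IsNewform0 f)
    (hQ : coeffField f = ⊥) (hpN : ¬ p ∣ N) (hap : cuspCoeff f p = ((0 : ℤ) : ℂ)) (m : ℕ) :
    (cyclotomicOmegaPlus p (2 * m + 1)).map (Int.castRingHom ℚ) ∣
      quadraticBranchMazurTateElement p f (2 * m + 1) := by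
  induction m with
  | zero =>
    rw [show 2 * 0 + 1 = 2 * 0 + 1 from rfl, cyclotomicOmegaPlus_two_mul_add_one, mul_zero,
      cyclotomicOmegaPlus_zero, Polynomial.map_one]
    exact one_dvd _
  | succ m ih =>
    obtain ⟨C, hC⟩ := cyclotomicOmega_dvd_quadraticBranchMazurTateElement_add hf0 hQ hpN hap (2 * m + 1)
    have h : quadraticBranchMazurTateElement p f (2 * (m + 1) + 1) =
        (cyclotomicOmega p (2 * m + 1 + 1)).map (Int.castRingHom ℚ) * C -
          ((cyclotomic (p ^ (2 * m + 1 + 1)) ℤ).comp (X + 1)).map (Int.castRingHom ℚ) *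
            quadraticBranchMazurTateElement p f (2 * m + 1) := by
      rw [show 2 * (m + 1) + 1 = 2 * m + 1 + 2 by ring, ← hC, add_sub_cancel_right]
    have hω : cyclotomicOmegaPlus p (2 * (m + 1) + 1) =
        cyclotomicOmegaPlus p (2 * m + 1) * (cyclotomic (p ^ (2 * m + 1 + 1)) ℤ).comp (X + 1) := by
      rw [show 2 * (m + 1) + 1 = 2 * (m + 1) + 1 from rfl, cyclotomicOmegaPlus_two_mul_add_one,
        show 2 * (m + 1) = 2 * m + 2 by ring, cyclotomicOmegaPlus_two_mul_add_two,
        cyclotomicOmegaPlus_two_mul_add_one, show 2 * m + 1 + 1 = 2 * m + 2 by ring]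
    rw [h, hω, Polynomial.map_mul]
    refine dvd_sub (Dvd.dvd.mul_right ?_ _) ?_
    · rw [← Polynomial.map_mul, ← hω, ← X_mul_cyclotomicOmegaPlus_mul_cyclotomicOmegaMinus,
        show 2 * m + 1 + 1 = 2 * (m + 1) by ring, cyclotomicOmegaPlus_two_mul_add_one]
      exact Polynomial.map_dvd _ (Dvd.dvd.mul_right (dvd_mul_left _ _) _)
    · rw [mul_comm (((cyclotomic (p ^ (2 * m + 1 + 1)) ℤ).comp (X + 1)).map (Int.castRingHom ℚ))]
      exact mul_dvd_mul ih dvd_rfl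

omit [NeZero N] [Fact p.Prime] in
/-- Exact division by a monic divisor: `D · (P /ₘ D) = P` when `D ∣ P`. [folklore] -/
theorem mul_divByMonic_eq_of_monic_of_dvd {R : Type*} [CommRing R] {D P : R[X]} (hD : D.Monic)
    (h : D ∣ P) : D * (P /ₘ D) = P := by
  have h1 := modByMonic_add_div P D
  rwa [(modByMonic_eq_zero_iff_dvd hD).mpr h, zero_add] at h1

/-- **Compatibility of the odd-level quotients** `ℓ_m = θ_{2m+1}(η)/ω⁺_{2m+1}`:
`T ω⁻_{2m+1} ∣ (−1)^{m+2} ℓ_{m+1} − (−1)^{m+1} ℓ_m` (three-term relation at level `2m+1` with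
`ω_{2m+2} = T ω⁻_{2m+1} · ω⁺_{2m+1} Φ_{p^{2m+2}}(1+T)`). Port of the tree's
`X_mul_cyclotomicOmegaMinus_dvd_sub_plus`. [cite: Pollack2003, Prop. 6.18 (proof)] -/
theorem X_mul_cyclotomicOmegaMinus_dvd_sub_quadraticBranch (hf0 : IsNewform0 f)
    (hQ : coeffField f = ⊥) (hpN : ¬ p ∣ N) (hap : cuspCoeff f p = ((0 : ℤ) : ℂ)) (m : ℕ) :
    X * (cyclotomicOmegaMinus p (2 * m + 1)).map (Int.castRingHom ℚ) ∣
      (-1) ^ (m + 2) * (quadraticBranchMazurTateElement p f (2 * (m + 1) + 1) /ₘ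
          (cyclotomicOmegaPlus p (2 * (m + 1) + 1)).map (Int.castRingHom ℚ)) -
        (-1) ^ (m + 1) * (quadraticBranchMazurTateElement p f (2 * m + 1) /ₘ
          (cyclotomicOmegaPlus p (2 * m + 1)).map (Int.castRingHom ℚ)) := by
  obtain ⟨C, hC⟩ := cyclotomicOmega_dvd_quadraticBranchMazurTateElement_add hf0 hQ hpN hap (2 * m + 1)
  set ξ : ℚ[X] := ((cyclotomic (p ^ (2 * m + 1 + 1)) ℤ).comp (X + 1)).map (Int.castRingHom ℚ)
    with hξ
  set ωp : ℚ[X] := (cyclotomicOmegaPlus p (2 * m + 1)).map (Int.castRingHom ℚ) with hωp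
  set ωm : ℚ[X] := (cyclotomicOmegaMinus p (2 * m + 1)).map (Int.castRingHom ℚ) with hωm
  set ℓ₀ := quadraticBranchMazurTateElement p f (2 * m + 1) /ₘ ωp with hℓ₀
  set ℓ₁ := quadraticBranchMazurTateElement p f (2 * (m + 1) + 1) /ₘ
    (cyclotomicOmegaPlus p (2 * (m + 1) + 1)).map (Int.castRingHom ℚ) with hℓ₁
  have hω1 : cyclotomicOmegaPlus p (2 * (m + 1) + 1) =
      cyclotomicOmegaPlus p (2 * m + 1) * (cyclotomic (p ^ (2 * m + 1 + 1)) ℤ).comp (X + 1) := by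
    rw [show 2 * (m + 1) + 1 = 2 * (m + 1) + 1 from rfl, cyclotomicOmegaPlus_two_mul_add_one,
      show 2 * (m + 1) = 2 * m + 2 by ring, cyclotomicOmegaPlus_two_mul_add_two,
      cyclotomicOmegaPlus_two_mul_add_one, show 2 * m + 1 + 1 = 2 * m + 2 by ring]
  have hmon0 : ωp.Monic := (monic_cyclotomicOmegaPlus p (2 * m + 1)).map _
  have hmon1 : ((cyclotomicOmegaPlus p (2 * (m + 1) + 1)).map (Int.castRingHom ℚ)).Monic :=
    (monic_cyclotomicOmegaPlus p _).map _
  have hθ0 : quadraticBranchMazurTateElement p f (2 * m + 1) = ωp * ℓ₀ :=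
    (mul_divByMonic_eq_of_monic_of_dvd hmon0
      (cyclotomicOmegaPlus_dvd_quadraticBranchMazurTateElement hf0 hQ hpN hap m)).symm
  have hθ1 : quadraticBranchMazurTateElement p f (2 * (m + 1) + 1) = ωp * ξ * ℓ₁ := by
    have h := (mul_divByMonic_eq_of_monic_of_dvd hmon1
      (cyclotomicOmegaPlus_dvd_quadraticBranchMazurTateElement hf0 hQ hpN hap (m + 1))).symm
    rw [h, ← hℓ₁, hω1, Polynomial.map_mul]
  have hΩ : (cyclotomicOmega p (2 * m + 1 + 1)).map (Int.castRingHom ℚ) = X * ωm * (ωp * ξ) := by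
    rw [← X_mul_cyclotomicOmegaPlus_mul_cyclotomicOmegaMinus,
      show 2 * m + 1 + 1 = 2 * m + 2 by ring, cyclotomicOmegaPlus_two_mul_add_two,
      ← cyclotomicOmegaMinus_two_mul_add_one, ← cyclotomicOmegaPlus_two_mul_add_one,
      Polynomial.map_mul, Polynomial.map_mul, Polynomial.map_mul, Polynomial.map_X]
    ring
  have hne : ωp * ξ ≠ 0 :=
    (hmon0.mul ((monic_cyclotomic_comp_X_add_one (p ^ (2 * m + 1 + 1))).map _)).ne_zero
  have hkey : ℓ₁ + ℓ₀ = X * ωm * C := by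
    rw [show 2 * m + 1 + 2 = 2 * (m + 1) + 1 by ring, hθ1, hθ0, hΩ] at hC
    have h2 : ωp * ξ * (ℓ₁ + ℓ₀) = ωp * ξ * (X * ωm * C) := by linear_combination hC
    exact mul_left_cancel₀ hne h2
  refine ⟨(-1) ^ (m + 2) * C, ?_⟩
  have h3 : ((-1 : ℚ[X]) ^ (m + 1)) = -((-1) ^ (m + 2)) := by ring
  rw [h3]
  linear_combination ((-1 : ℚ[X]) ^ (m + 2)) * hkey

end Quotients

end Summit.BirchSwinnertonDyer.Rank1Residual.Additive

end
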